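import Literature.RingTheory.Flat.AmitsurDegreeZero
import HarnessLib

/-!
# The Amitsur complex in degree ONE for MODULES: `S ⊗_R N → S ⊗_R S ⊗_R N → S ⊗_R S ⊗_R S ⊗_R N` is exact for `R → S` faithfully flat

Topic `Literature/RingTheory/Flat`, namespace `Literature.RingTheory.Flat`.  THEOREMS ONLY; no definition, no named fact, no
instance, no notation, no `sorry`.  Sibling of ★ `AmitsurDegreeZero` (degree zero: `0 → N → S ⊗_R N ⇉ S ⊗_R S ⊗_R N`), one
level up, with the SAME splitting device.

Grothendieck's faithfully flat descent ([SGA1] Exp. VIII §1; [StacksProject, Tag 023M] «the Amitsur complex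
`N → N ⊗_R S → N ⊗_R S ⊗_R S → N ⊗_R S ⊗_R S ⊗_R S → …` is universally exact for `R → S` faithfully flat»; [GortzWedhorn2020]
Lemma 14.65 ∕ Thm. 14.66): for a commutative ring map `R → S` that is FAITHFULLY FLAT and ANY `R`-module `N`, the complex is
exact at `S ⊗_R S ⊗_R N` — «every Amitsur `1`-cocycle is a coboundary» (the `H¹ = 0` that descends torsors ∕ gluing data of
quasi-coherent modules along an fpqc cover).  Spelling (as in ★ `AmitsurDegreeZero`: new `S`-factors on the LEFT, Mathlib's
`TensorProduct.mk _ S _ 1 = (1 ⊗ –)` and `LinearMap.lTensor S`):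

* the three cofaces `S ⊗ S ⊗ N → S ⊗ S ⊗ S ⊗ N` are `∂₀ = 1 ⊗ –`, `∂₁ = S ⊗ (1 ⊗ –)`, `∂₂ = S ⊗ S ⊗ (1 ⊗ –)`; the degree-one
  differential of ★ `AmitsurDegreeZero.exact_mk_one_sub` is `d₁ = S ⊗ (1 ⊗ –) − (1 ⊗ –)`, and the degree-two differential with
  the matching signs is `d₂ = ∂₂ − ∂₁ + ∂₀`;
* `coface_two_comp_coface_one` — `d₂ ∘ d₁ = 0`;
* **`exact_coface_one_two`** — `Function.Exact d₁ d₂` for `R → S` faithfully flat; element forms `mem_range_coface_one_iff`,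
  `exists_eq_coface_one_of_coface_two_eq_zero`.

Proof: after the faithfully flat base change `S ⊗_R –` the contraction `c : s ⊗ s′ ⊗ x ↦ ss′ ⊗ x` of ★ `AmitsurDegreeZero`
(`contract_tmul`, `contract_lTensor_mk_one`) is natural in the coefficient module (`contract_lTensor_lTensor`, this file), whence
the homotopy identity `c (S ⊗ d₂) y = (S ⊗ d₁) (c y) + y` (`contract_lTensor_coface_two`); so a base-changed cocycle `y` is the
coboundary of `−c y`, and Mathlib's `Module.FaithfullyFlat.lTensor_reflects_exact` pulls exactness back.  Mathlib has neither
degree (only `Algebra.TensorProduct.IsEffective.of_faithfullyFlat`, `N = R`, degree zero).  Written for cell `hodgecm-mathlib`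
(P6b σ2, E2a road KF1♭ step S8: descent of the torsor of unit-lifts along a finite faithfully flat cover); HC_CM is proved only
modulo the 7 printed citations until rung 0 closes; nothing here is about HC.

## References
* [SGA1] A. Grothendieck, *SGA 1*, Exp. VIII §1 (descente fidèlement plate), Lemma 1.5.
* [StacksProject] The Stacks Project, Tag 023M (Descent, Lemma 35.3.6).
* [GortzWedhorn2020] U. Görtz, T. Wedhorn, *Algebraic Geometry I*, 2nd ed. (2020), Lemma 14.65, Thm. 14.66.
-/

universe u v w

open TensorProduct

namespace Literature.RingTheory.Flat

variable (R : Type u) (S : Type v) [CommRing R] [CommRing S] [Algebra R S]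

/-- The contraction `c : S ⊗_R (S ⊗_R P) → S ⊗_R P`, `s ⊗ (s′ ⊗ p) ↦ ss′ ⊗ p` of ★ `AmitsurDegreeZero` is NATURAL in the
coefficient module: for `φ : P → Q`, `c_Q ∘ (S ⊗ S ⊗ φ) = (S ⊗ φ) ∘ c_P` (on `s ⊗ s′ ⊗ p` both sides give `ss′ ⊗ φ p`).
[cite: StacksProject, Tag 023M] -/
theorem contract_lTensor_lTensor {P : Type w} [AddCommGroup P] [Module R P] {Q : Type w} [AddCommGroup Q] [Module R Q]
    (φ : P →ₗ[R] Q) (y : S ⊗[R] (S ⊗[R] P)) :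
    ((LinearMap.rTensor Q (LinearMap.mul' R S)) ∘ₗ (TensorProduct.assoc R S S Q).symm.toLinearMap)
        (LinearMap.lTensor S (LinearMap.lTensor S φ) y) =
      LinearMap.lTensor S φ
        (((LinearMap.rTensor P (LinearMap.mul' R S)) ∘ₗ (TensorProduct.assoc R S S P).symm.toLinearMap) y) := by
  induction y using TensorProduct.induction_on with
  | zero => simp
  | tmul s z =>
      induction z using TensorProduct.induction_on with
      | zero => simp
      | tmul s' p => simp
      | add z z' hz hz' => simp only [tmul_add, map_add, hz, hz']
  | add x y hx hy => simp only [map_add, hx, hy]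

variable (N : Type w) [AddCommGroup N] [Module R N]

/-- **`d₂ ∘ d₁ = 0`** for the Amitsur cofaces with module coefficients: `d₁ = S ⊗ (1 ⊗ –) − (1 ⊗ –) : S ⊗ N → S ⊗ S ⊗ N`
(★ `AmitsurDegreeZero`) and `d₂ = S ⊗ S ⊗ (1 ⊗ –) − S ⊗ (1 ⊗ –) + (1 ⊗ –) : S ⊗ S ⊗ N → S ⊗ S ⊗ S ⊗ N` (on `s ⊗ n`:
`(s⊗1⊗1⊗n − s⊗1⊗1⊗n + 1⊗s⊗1⊗n) − (1⊗s⊗1⊗n − 1⊗1⊗s⊗n + 1⊗1⊗s⊗n) = 0`). [cite: StacksProject, Tag 023M] -/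
theorem coface_two_comp_coface_one :
    (LinearMap.lTensor S (LinearMap.lTensor S (TensorProduct.mk R S N 1))
          - LinearMap.lTensor S (TensorProduct.mk R S (S ⊗[R] N) 1)
          + TensorProduct.mk R S (S ⊗[R] (S ⊗[R] N)) 1) ∘ₗ
      (LinearMap.lTensor S (TensorProduct.mk R S N 1) - TensorProduct.mk R S (S ⊗[R] N) 1) = 0 := by
  apply TensorProduct.ext'
  intro s n
  simp only [LinearMap.coe_comp, Function.comp_apply, LinearMap.sub_apply, LinearMap.add_apply, map_sub,
    LinearMap.lTensor_tmul, TensorProduct.mk_apply, LinearMap.zero_apply]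
  abel

/-- **The homotopy identity** of the base-changed degree-one Amitsur complex: for `y ∈ S ⊗ (S ⊗ S ⊗ N)`,
`c ((S ⊗ d₂) y) = (S ⊗ d₁) (c y) + y`, where `c` is the contraction of ★ `AmitsurDegreeZero` (`c ∘ (S ⊗ ∂₀) = id`,
`c ∘ (S ⊗ ∂₁) = (S ⊗ (1 ⊗ –)) ∘ c`, `c ∘ (S ⊗ ∂₂) = (S ⊗ S ⊗ (1 ⊗ –)) ∘ c` by naturality). [cite: StacksProject, Tag 023M] -/
theorem contract_lTensor_coface_two (y : S ⊗[R] (S ⊗[R] (S ⊗[R] N))) :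
    ((LinearMap.rTensor (S ⊗[R] (S ⊗[R] N)) (LinearMap.mul' R S)) ∘ₗ
          (TensorProduct.assoc R S S (S ⊗[R] (S ⊗[R] N))).symm.toLinearMap)
        (LinearMap.lTensor S
          (LinearMap.lTensor S (LinearMap.lTensor S (TensorProduct.mk R S N 1))
            - LinearMap.lTensor S (TensorProduct.mk R S (S ⊗[R] N) 1)
            + TensorProduct.mk R S (S ⊗[R] (S ⊗[R] N)) 1) y) =
      LinearMap.lTensor S (LinearMap.lTensor S (TensorProduct.mk R S N 1) - TensorProduct.mk R S (S ⊗[R] N) 1)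
          (((LinearMap.rTensor (S ⊗[R] N) (LinearMap.mul' R S)) ∘ₗ
            (TensorProduct.assoc R S S (S ⊗[R] N)).symm.toLinearMap) y) + y := by
  rw [LinearMap.lTensor_add, LinearMap.lTensor_sub, LinearMap.add_apply, LinearMap.sub_apply, map_add, map_sub,
    contract_lTensor_lTensor R S (LinearMap.lTensor S (TensorProduct.mk R S N 1)) y,
    contract_lTensor_lTensor R S (TensorProduct.mk R S (S ⊗[R] N) 1) y,
    contract_lTensor_mk_one R S (S ⊗[R] (S ⊗[R] N)) y, LinearMap.lTensor_sub, LinearMap.sub_apply]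

variable [Module.FaithfullyFlat R S]

/-- **Amitsur exactness in degree ONE for modules** ([StacksProject, Tag 023M]; [SGA1] VIII Lemma 1.5; [GortzWedhorn2020]
Lemma 14.65): for `R → S` faithfully flat and any `R`-module `N`, the complex `S ⊗_R N —d₁→ S ⊗_R S ⊗_R N —d₂→ S ⊗_R S ⊗_R S ⊗_R N`
is exact, `d₁ = S ⊗ (1 ⊗ –) − (1 ⊗ –)`, `d₂ = S ⊗ S ⊗ (1 ⊗ –) − S ⊗ (1 ⊗ –) + (1 ⊗ –)`: an element of `S ⊗ S ⊗ N` killed by `d₂`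
(a `1`-COCYCLE) is `d₁` of an element of `S ⊗ N` (a COBOUNDARY).  Proof: after `S ⊗_R –` a cocycle `y` equals `(S ⊗ d₁) (−c y)`
by `contract_lTensor_coface_two`; Mathlib `Module.FaithfullyFlat.lTensor_reflects_exact`.
[cite: StacksProject, Tag 023M] [cite: SGA1, Exp. VIII Lemma 1.5] [cite: GortzWedhorn2020, Lemma 14.65] -/
theorem exact_coface_one_two :
    Function.Exact
      (LinearMap.lTensor S (TensorProduct.mk R S N 1) - TensorProduct.mk R S (S ⊗[R] N) 1)
      (LinearMap.lTensor S (LinearMap.lTensor S (TensorProduct.mk R S N 1))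
        - LinearMap.lTensor S (TensorProduct.mk R S (S ⊗[R] N) 1)
        + TensorProduct.mk R S (S ⊗[R] (S ⊗[R] N)) 1) := by
  apply Module.FaithfullyFlat.lTensor_reflects_exact R S
  intro y
  constructor
  · intro hy
    have key := contract_lTensor_coface_two R S N y
    rw [hy, map_zero] at key
    refine ⟨-(((LinearMap.rTensor (S ⊗[R] N) (LinearMap.mul' R S)) ∘ₗ
      (TensorProduct.assoc R S S (S ⊗[R] N)).symm.toLinearMap) y), ?_⟩
    rw [map_neg, neg_eq_iff_eq_neg, eq_neg_iff_add_eq_zero]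
    exact key.symm
  · rintro ⟨x, rfl⟩
    rw [← LinearMap.comp_apply, ← LinearMap.lTensor_comp, coface_two_comp_coface_one, LinearMap.lTensor_zero,
      LinearMap.zero_apply]

/-- Element form: `y ∈ S ⊗_R S ⊗_R N` is a coboundary (`y ∈ range d₁`) iff it is a cocycle (`d₂ y = 0`), i.e. iff
`(S ⊗ S ⊗ (1 ⊗ –)) y + (1 ⊗ –) y = (S ⊗ (1 ⊗ –)) y`. [cite: StacksProject, Tag 023M] [cite: GortzWedhorn2020, Lemma 14.65] -/
theorem mem_range_coface_one_iff (y : S ⊗[R] (S ⊗[R] N)) :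
    y ∈ Set.range (LinearMap.lTensor S (TensorProduct.mk R S N 1) - TensorProduct.mk R S (S ⊗[R] N) 1) ↔
      LinearMap.lTensor S (LinearMap.lTensor S (TensorProduct.mk R S N 1)) y + TensorProduct.mk R S (S ⊗[R] (S ⊗[R] N)) 1 y =
        LinearMap.lTensor S (TensorProduct.mk R S (S ⊗[R] N) 1) y := by
  rw [← (exact_coface_one_two R S N) y, LinearMap.add_apply, LinearMap.sub_apply, sub_add_eq_add_sub, sub_eq_zero]

/-- **Every Amitsur `1`-cocycle is a coboundary** (`∃` form of `exact_coface_one_two`): if `y ∈ S ⊗_R S ⊗_R N` satisfies the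
cocycle identity `∂₂ y + ∂₀ y = ∂₁ y`, then `y = s ⊗ 1 ⊗ n`-part minus `1 ⊗ s ⊗ n`-part of some `x ∈ S ⊗_R N`, i.e.
`y = (S ⊗ (1 ⊗ –)) x − (1 ⊗ –) x`. [cite: StacksProject, Tag 023M] [cite: GortzWedhorn2020, Lemma 14.65] -/
theorem exists_eq_coface_one_of_cocycle (y : S ⊗[R] (S ⊗[R] N))
    (hy : LinearMap.lTensor S (LinearMap.lTensor S (TensorProduct.mk R S N 1)) y +
        TensorProduct.mk R S (S ⊗[R] (S ⊗[R] N)) 1 y =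
      LinearMap.lTensor S (TensorProduct.mk R S (S ⊗[R] N) 1) y) :
    ∃ x : S ⊗[R] N, LinearMap.lTensor S (TensorProduct.mk R S N 1) x - TensorProduct.mk R S (S ⊗[R] N) 1 x = y := by
  obtain ⟨x, hx⟩ := (mem_range_coface_one_iff R S N y).2 hy
  exact ⟨x, by rw [← hx, LinearMap.sub_apply]⟩

end Literature.RingTheory.Flat
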